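import Summits.ResolutionOfSingularities.ResolutionOfSingularities.Theorems.MarkedTransferCampaignG1PnegaObligationF33StdSandwich
import Literature.AlgebraicGeometry.Hironaka2017.S09LLUED.R057HFlat
import HarnessLib

/-!
# [OURS · G2 / R05 material from the F3.3 machinery] Rem. 9.9 (1), Rem. 9.10 (1)_ours, Rem. 9.11 (3) and Def. 9.12's order clause
# AT THE COMPLETION `K'[[x]]` with the exact Hasse family — which FOLLOW, and modulo what. By res-type-063; carried by res-L1-type-o6.

CARRIER NOTE (res-L1-type-o6 g17): KERNEL by res-type-063 (HOME draft `D/res-type-063/PnegaObligationF33StdR05.draft.lean` sha16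
4d8963a1d7b1e23b, DRAFT READY 2026-08-27T06:03:50Z, SELF-FILE NOTICE 06:19:23Z — carried instead, TAKING 06:22:07Z), summit-side
VERBATIM (this note added; «carried by» corrected). [OURS · L1 G1/G2] replaces the role of: nothing printed beyond what the decl
docstrings cite — instances of the typed R05 candidates Rem. 9.9 (1) / Rem. 9.10 (1) / Rem. 9.11 (3) / Def. 9.12 order clause at the
completion `K'[[x]]` with the exact Hasse family, kernel material for res-adj-2's readings; NOT a statement of the manuscript.
HONEST FRAMING. Nothing here is a statement of H. Hironaka's manuscript *Resolution of singularities in positive characteristics*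
(2017-03-23, [Hironaka2017], lit key `paper:url-3343fd9e678b`; every printed item is a CANDIDATE [claim: Hironaka2017, status:
under-review]). The typed items `S09LLUED.Rem9_9_1`, `Rem9_10_1_ours`, `Rem9_11_3` (row 057, GAP R05) are candidate Props; this file
proves INSTANCES of them at `R = K'[[x]]`, `D = hasseFamily` (the divided-power derivatives of the frame), with every extra hypothesis
NAMED in the signature — kernel material for res-adj-2's readings, no verdict words. AI kernel work, weaker than expert review;
nothing here is progress on resolution of singularities in positive characteristic; no claim beyond the kernel.

## What is proved (all at `R = MvPowerSeries (Fin n) K'`, `K'` a field, `D = PnegaObligation.hasseFamily K' n`)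
* `Rem9_10_1_ours_hasseFamily` — **Rem. 9.10 (1) (OURS reading) FOLLOWS unconditionally**: `ord(x^{α+pβ}·∂^{(α+pβ)}ϵ) = ord(∂^{(α+pβ)}ϵ)
  + |α+pβ|` (a domain: Mathlib `order_mul`; `order_mono_X`) and `ord ϵ ≤ ord(∂^{(α+pβ)}ϵ) + |α+pβ|` (tree `order_le_order_hasseDeriv_add_degree`).
* `Rem9_9_1_hasseFamily_of_order_eq`, `Rem9_11_3_hasseFamily_of_order_eq` — **Rem. 9.9 (1) and Rem. 9.11 (3) FOLLOW MODULO the order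
  clause `ord ϵ(0) = |α+pβ+qγ₀|`** (their own second inequality «… ≥ ord_ξ(ϵ(0))» IS that clause's direction `|α+pβ+qγ₀| ≤ ord ϵ(0)`,
  Lem. 9.6's proof p.50 L24 gives the other); WITHOUT it the first claim fails at the unit datum (`CaseIDatum.isUnit_value`, p500499:
  `ord H♭ = 0 < 2·ord ϵ(0) − |α+pβ+qγ₀|`).
* `HFlat_op_adicOrder_ge_of_order_eq` — **Def. 9.12 «orders ≥ ord_ξ(ϵ)» (the order half of `U51_2`) FOLLOWS MODULO the order clause**, for
  every case witness (Case (III) by the iterate bound `le_order_iterate_pre`).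
-/

noncomputable section

set_option linter.dupNamespace false -- mandated namespace of this single-conjunct summit

namespace Summit.ResolutionOfSingularities.ResolutionOfSingularities.Theorems.Campaign.PnegaObligation

open Literature.AlgebraicGeometry.Hironaka2017 Literature.AlgebraicGeometry.Hironaka2017.S09LLUED
open Literature.RingTheory.MvPowerSeries (hasseDeriv order_le_order_hasseDeriv_add_degree adicOrder_eq_order)
open Literature.AlgebraicGeometry.Resolution (adicOrder)
open MvPowerSeries (X)

universe v

section R05

variable {K' : Type v} [Field K'] {n : ℕ}

/-- **Rem. 9.10 (1), OURS reading (`Rem9_10_1_ours`), at `K'[[x]]` with the exact Hasse family — UNCONDITIONAL.** [folklore] -/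
theorem Rem9_10_1_ours_hasseFamily (p : ℕ) (α β : Fin n →₀ ℕ) (ε0 : MvPowerSeries (Fin n) K') :
    Rem9_10_1_ours (X : Fin n → MvPowerSeries (Fin n) K') (hasseFamily K' n) p α β ε0 := by
  constructor
  · unfold HFlat.caseII hasseFamily
    rw [adicOrder_eq_order, adicOrder_eq_order, MvPowerSeries.order_mul, order_mono_X, add_comm]
  · unfold hasseFamily
    rw [adicOrder_eq_order, adicOrder_eq_order]
    exact order_le_order_hasseDeriv_add_degree (α + p • β) ε0

/-- **Rem. 9.11 (3) (`Rem9_11_3`) at `K'[[x]]` with the exact Hasse family, MODULO the order clause `ord ϵ(0) = |α+pβ+qγ₀|`.** The first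
printed inequality `2·ord ϵ(0) ≤ ord(h♭ϵ(0)) + |α+pβ+qγ₀|` then holds by `le_order_pre_of_le_order`; the second IS the clause. [folklore] -/
theorem Rem9_11_3_hasseFamily_of_order_eq (p q : ℕ) (α β γ₀ : Fin n →₀ ℕ) (ε0 : MvPowerSeries (Fin n) K')
    (hord : adicOrder ε0 = ((α + p • β + q • γ₀).degree : ℕ∞)) :
    Rem9_11_3 (hasseFamily K' n) p q α β γ₀ ε0 := by
  have hsplit : (α + p • β + q • γ₀).degree = (α + p • β).degree + (q • γ₀).degree := map_add _ _ _
  have hε : (((α + p • β).degree + (q • γ₀).degree : ℕ) : ℕ∞) ≤ ε0.order := by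
    rw [← adicOrder_eq_order, hord, hsplit]
  have hpre := le_order_pre_of_le_order p q α β γ₀ ε0 hε
  refine ⟨?_, ?_⟩
  · show adicOrder ε0 + adicOrder ε0 ≤ adicOrder (HFlat.pre (hasseFamily K' n) p q α β γ₀ ε0) + _
    rw [hord, adicOrder_eq_order, hsplit]
    exact add_le_add_left hpre _
  · show adicOrder ε0 + _ ≤ adicOrder ε0 + adicOrder ε0
    rw [hord]

/-- **Rem. 9.9 (1) (`Rem9_9_1`) at `K'[[x]]` with the exact Hasse family, MODULO the order clause** (any unit `u₀`; the case hypothesis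
of Lem. 9.6 (I) is not even needed for the inequality). WITHOUT the clause the first inequality fails at the unit datum of
`…F33StdCaseI` (`ord H♭ = 0`). [folklore] -/
theorem Rem9_9_1_hasseFamily_of_order_eq (u₀ : (MvPowerSeries (Fin n) K')ˣ) (p q : ℕ) (α β γ₀ : Fin n →₀ ℕ)
    (ε0 : MvPowerSeries (Fin n) K') (hord : adicOrder ε0 = ((α + p • β + q • γ₀).degree : ℕ∞)) :
    Rem9_9_1 (hasseFamily K' n) u₀ p q α β γ₀ ε0 := by
  have hsplit : (α + p • β + q • γ₀).degree = (α + p • β).degree + (q • γ₀).degree := map_add _ _ _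
  have hε : (((α + p • β).degree + (q • γ₀).degree : ℕ) : ℕ∞) ≤ ε0.order := by
    rw [← adicOrder_eq_order, hord, hsplit]
  have hI : (((α + p • β).degree + (q • γ₀).degree : ℕ) : ℕ∞) ≤ (HFlat.caseI (hasseFamily K' n) u₀ p q α β γ₀ ε0).order := by
    unfold HFlat.caseI
    rw [mul_assoc, MvPowerSeries.order_mul]
    exact le_add_left (le_order_pre_of_le_order p q α β γ₀ ε0 hε)
  refine ⟨?_, ?_⟩
  · show adicOrder ε0 + adicOrder ε0 ≤ adicOrder (HFlat.caseI (hasseFamily K' n) u₀ p q α β γ₀ ε0) + _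
    rw [hord, adicOrder_eq_order, hsplit]
    exact add_le_add_left hI _
  · show adicOrder ε0 + _ ≤ adicOrder ε0 + adicOrder ε0
    rw [hord]

/-- **Def. 9.12 «with orders ≥ ord_ξ(ϵ)» (order half of `U51_2`) at `K'[[x]]`, MODULO the order clause**, for every case witness of
Lem. 9.6 (`le_order_HFlat_op`). [folklore] -/
theorem HFlat_op_adicOrder_ge_of_order_eq (u₀ : (MvPowerSeries (Fin n) K')ˣ) (p q : ℕ) (α β γ₀ : Fin n →₀ ℕ)
    (c : HFlat.Case p q α β γ₀) (ε0 : MvPowerSeries (Fin n) K') (hord : adicOrder ε0 = ((α + p • β + q • γ₀).degree : ℕ∞)) :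
    adicOrder ε0 ≤ adicOrder (HFlat.op X (hasseFamily K' n) u₀ p q α β γ₀ c ε0) := by
  have hsplit : (α + p • β + q • γ₀).degree = (α + p • β).degree + (q • γ₀).degree := map_add _ _ _
  have hord' : ε0.order = ((α + p • β + q • γ₀).degree : ℕ∞) := by rw [← adicOrder_eq_order, hord]
  rw [hord, adicOrder_eq_order, hsplit]
  exact le_order_HFlat_op u₀ p q α β γ₀ c ε0 hord'

/-- The same for an ORDER-reading datum: `ord ϵ(0) ≤ ord H♭(ϵ(0))`. [folklore] -/
theorem HFlatDatumOrd.adicOrder_le_value {p : ℕ} {P : ℕ → Ideal (MvPowerSeries (Fin n) K')} (d : HFlatDatumOrd p K' n P) :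
    adicOrder d.ε0 ≤ adicOrder d.toHFlatDatum.value :=
  HFlat_op_adicOrder_ge_of_order_eq d.u₀ p d.q d.α d.β d.γ₀ d.case d.ε0 d.ord_eq

/-- WITHOUT the order clause Rem. 9.9 (1)'s first inequality FAILS at the unit datum of `…F33StdCaseI` (`q = p²`): there
`ord H♭(ϵ(0)) = 0` while `2·ord ϵ(0) − |α+pβ+qγ₀| > 0` is not needed — the typed `Rem9_9_1` even asks `ord ϵ(0) + |α+pβ+qγ₀| ≤ 2·ord ϵ(0)`,
i.e. the clause's direction, which the datum violates (`CaseIDatum.adicOrder_eps0_ne` records `ord ϵ(0) ≠ |α+pβ+qγ₀|`; here the sharper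
`ord ϵ(0) < |α+pβ+qγ₀|`). [folklore] -/
theorem CaseIDatum.not_Rem9_9_1 (K : Type v) [Field K] (p : ℕ) [Fact p.Prime] [CharP K p] :
    ¬ Rem9_9_1 (hasseFamily K 3) (CaseIDatum.datum K p).u₀ p (CaseIDatum.datum K p).q (CaseIDatum.datum K p).α
      (CaseIDatum.datum K p).β (CaseIDatum.datum K p).γ₀ (CaseIDatum.eps0 K p) := by
  classical
  intro h
  obtain ⟨-, h2⟩ := h
  -- `ord ϵ(0) + N ≤ 2 ord ϵ(0)` with `ord ϵ(0) ≤ 2p²−2 < N = 4p²−2` is impossible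
  have h4 := CaseIDatum.four_le_sq p
  rw [CaseIDatum.datum_alpha, CaseIDatum.datum_beta, CaseIDatum.datum_gamma, CaseIDatum.datum_q, CaseIDatum.T1_exp,
    CaseIDatum.degree_θ, adicOrder_eq_order] at h2
  have hle : (CaseIDatum.eps0 K p).order ≤ ((p ^ 2 - 1 + (p ^ 2 - 1) : ℕ) : ℕ∞) := by
    have h := MvPowerSeries.order_le (f := CaseIDatum.eps0 K p) (d := CaseIDatum.θ (p ^ 2 - 1) (p ^ 2 - 1)) (by
      rw [CaseIDatum.coeff_eps0, if_neg, if_pos rfl, if_neg] <;> [simp; (intro h'; have := (CaseIDatum.θ_injective h').1; omega);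
        (intro h'; have := (CaseIDatum.θ_injective h').1; omega)])
    rwa [CaseIDatum.degree_θ] at h
  -- `order` is finite (`eps0 ≠ 0`)
  have hfin : (CaseIDatum.eps0 K p).order ≠ ⊤ := fun ht => by
    rw [ht] at hle; exact absurd hle (by simp)
  obtain ⟨o, ho⟩ := ENat.ne_top_iff_exists.mp hfin
  rw [← ho] at h2 hle
  have hle' : o ≤ p ^ 2 - 1 + (p ^ 2 - 1) := by exact_mod_cast hle
  have h2' : o + (2 * p ^ 2 - 1 + (2 * p ^ 2 - 1)) ≤ o + o := by exact_mod_cast h2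
  omega

end R05

end Summit.ResolutionOfSingularities.ResolutionOfSingularities.Theorems.Campaign.PnegaObligation
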